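import Mathlib
import Summits.Ventures.PercRepro2.PosClassCut

/-!
# The split placements across a cut vertex: two marks on each side, or all four on one side
(blind cell PercRepro2, p5 g8, 2026-08-26; `proofs/P5-POSCLASS.md` §2′)

With `PosClassCut.lean` (`w` behind the cut) and `PosClassMarks.lean` (a mark / the root behind the
cut) the remaining placements of `s, u, v, w` across a cut vertex `x` are: (i) ALL FOUR on one side —
the class statistic is the side statistic times the total count of the other side
(`stat_same_side`); (ii) TWO ON EACH SIDE, `s, u` on the `A`-side and `v, w` on the `B`-side
(`stat_split_out`): by the 0/1 cases of `1_{x ∈ C(s)}` the class «`w` outside» is `2 · N_A(f_u ;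
x red-only) · N_B(r_v (1 − r_w))`, a product of a typed-Harris count (`stat_one_nonneg` for the pair
`(u, x)`, via the copy swap) and a one-colour count — so (TB13) and (OS) hold on every such
instance OUTRIGHT (`tb13_split`, `os_split`), with no hypothesis on the sides.  Hence the pair
{(TB13), (OS)} is open only on the instances where no cut vertex separates any of the four marks
from the others, modulo the edge induction.  Own work; standard axioms.
-/

namespace Summit.Ventures.PercRepro2

namespace PosClass

open CovForm A3InactiveTyped CutV TB14Cut

section Split

variable {V : Type*} {E : Type*} [Fintype E] [DecidableEq E] {R : Type*} [Field R]
  [LinearOrder R] [IsStrictOrderedRing R]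
  {ends : E → Sym2 V} {x : V} {VA VB : Set V} {EA EB : Set E}
  [DecidablePred (· ∈ EA)] [DecidablePred (· ∈ EB)]

omit [Fintype E] [DecidableEq E] [LinearOrder R] [IsStrictOrderedRing R] in
/-- `iL` takes the values `0` and `1`. -/
lemma iL_zero_or_one (ends : E → Sym2 V) (a v : V) (y : Config E) :
    (iL ends a v y : R) = 0 ∨ (iL ends a v y : R) = 1 := by
  unfold iL
  by_cases h : y ∈ connEvent ends a v
  · right; simp [h]
  · left; simp [h]

omit [Fintype E] [DecidableEq E] [LinearOrder R] [IsStrictOrderedRing R] [DecidablePred (· ∈ EA)] in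
/-- `odd` of the root `x` and a `B`-side mark only sees the `B`-edges. -/
lemma odd_restrictB (h : IsCut ends x VA VB EA EB) {v : V} (hv : v ∈ VB) (y y' : Config E) :
    (odd ends x v y y' : R) = odd ends x v (restrict EB y) (restrict EB y') := by
  unfold odd
  rw [iL_restrictB h (Or.inr rfl) (Or.inl hv) y, iL_restrictB h (Or.inr rfl) (Or.inl hv) y']

omit [LinearOrder R] [IsStrictOrderedRing R] [DecidablePred (· ∈ EA)] [DecidablePred (· ∈ EB)] in
/-- The count of a negated kernel. -/
lemma pairCount_neg' (F : Finset E) (z : Config E) (Φ : Config E → Config E → R) :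
    pairCount F z (fun y y' => -Φ y y') = - pairCount F z Φ := by
  have := pairCount_const_mul F z (-1) Φ
  simp only [neg_one_mul] at this
  exact this

omit [LinearOrder R] [IsStrictOrderedRing R] in
/-- **All four marks on the `A`-side**: the class statistic is the `A`-side statistic times the
total count of the `B`-side profile. -/
theorem stat_same_side (h : IsCut ends x VA VB EA EB) (F : Finset E) (z : Config E)
    {s u v w : V} (hs : s ∈ VA ∪ {x}) (hu : u ∈ VA ∪ {x}) (hv : v ∈ VA ∪ {x}) (hw : w ∈ VA ∪ {x})
    (k : V → V → Config E → Config E → R)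
    (hk : ∀ (a b : V), (∀ y : Config E, (iL ends a b y : R) = iL ends a b (restrict EA y)) →
      ∀ y y', k a b y y' = k a b (restrict EA y) (restrict EA y')) :
    (stat F z ends s u v (k s w) : R) =
      stat (sideFree EA F) (restrict EA z) ends s u v (k s w) *
        pairCount (sideFree EB F) (restrict EB z) (fun _ _ => (1 : R)) := by
  have key := pairCount_mul_of_cut (R := R) h F z
    (fun y y' => odd ends s u y y' * odd ends s v y y' * k s w y y') (fun _ _ => 1)
    (by intro y y'
        rw [odd_restrictA h hs hu y y', odd_restrictA h hs hv y y',
          hk s w (fun y => iL_restrictA h hs hw y) y y'])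
    (by intro _ _; rfl)
  have e : (stat F z ends s u v (k s w) : R) =
      pairCount F z (fun y y' => odd ends s u y y' * odd ends s v y y' * k s w y y' * 1) := by
    unfold stat
    congr 1
    funext y y'
    ring
  rw [e, key]
  rfl

omit [Fintype E] [DecidableEq E] [LinearOrder R] [IsStrictOrderedRing R] in
/-- The pointwise composition for the split placement, class «outside»: with `a = 1_{x ∈ C_y(s)}`,
`a' = 1_{x ∈ C_{y'}(s)}` (each `0` or `1`), `f_u f_v kOut(s, w) = f_u · kRed(s, x) · r_v (1 − r_w) −
f_u · kBlue(s, x) · r_v' (1 − r_w') + f_u · kCore(s, x) · f^x_v kOut(x, w)`. -/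
lemma odd_mul_kOut_split (h : IsCut ends x VA VB EA EB) {s u v w : V} (hs : s ∈ VA ∪ {x})
    (hv : v ∈ VB) (hw : w ∈ VB) (y y' : Config E) :
    (odd ends s u y y' * odd ends s v y y' * kOut ends s w y y' : R) =
      odd ends s u y y' * kRed ends s x y y' * (iL ends x v y * (1 - iL ends x w y)) -
      odd ends s u y y' * kBlue ends s x y y' * (iL ends x v y' * (1 - iL ends x w y')) +
      odd ends s u y y' * kCore ends s x y y' *
        (odd ends x v y y' * kOut ends x w y y') := by
  have e1 := iL_across (R := R) h hs hv y
  have e2 := iL_across (R := R) h hs hv y'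
  have e3 := iL_across (R := R) h hs hw y
  have e4 := iL_across (R := R) h hs hw y'
  unfold odd kOut kRed kBlue kCore
  rw [e1, e2, e3, e4]
  rcases iL_zero_or_one (R := R) ends s x y with ha | ha <;>
    rcases iL_zero_or_one (R := R) ends s x y' with ha' | ha' <;> rw [ha, ha'] <;> ring

omit [Fintype E] [DecidableEq E] [LinearOrder R] [IsStrictOrderedRing R] in
/-- The pointwise composition for the split placement, class «red-only». -/
lemma odd_mul_kRed_split (h : IsCut ends x VA VB EA EB) {s u v w : V} (hs : s ∈ VA ∪ {x})
    (hv : v ∈ VB) (hw : w ∈ VB) (y y' : Config E) :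
    (odd ends s u y y' * odd ends s v y y' * kRed ends s w y y' : R) =
      odd ends s u y y' * kRed ends s x y y' * (iL ends x v y * iL ends x w y) +
      odd ends s u y y' * kCore ends s x y y' *
        (odd ends x v y y' * kRed ends x w y y') := by
  have e1 := iL_across (R := R) h hs hv y
  have e2 := iL_across (R := R) h hs hv y'
  have e3 := iL_across (R := R) h hs hw y
  have e4 := iL_across (R := R) h hs hw y'
  unfold odd kRed kCore
  rw [e1, e2, e3, e4]
  rcases iL_zero_or_one (R := R) ends s x y with ha | ha <;>
    rcases iL_zero_or_one (R := R) ends s x y' with ha' | ha' <;> rw [ha, ha'] <;> ring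

omit [DecidablePred (· ∈ EA)] [DecidablePred (· ∈ EB)] in
/-- The odd statistic is antisymmetric under the copy swap, the core kernel symmetric: the count of
`f_u · kCore(s, x)` vanishes. -/
lemma pairCount_odd_kCore (F : Finset E) (z : Config E) (s u a : V)
    (g : Config E → Config E → R) (hg : ∀ y y', g y y' = g y' y) :
    pairCount F z (fun y y' => odd ends s u y y' * kCore ends s a y y' * g y y') = 0 := by
  have hsw := pairCount_swap F z
    (fun y y' => odd ends s u y y' * kCore ends s a y y' * g y y' : Config E → Config E → R)
  have hneg : pairCount F z
      (fun y y' => odd ends s u y' y * kCore ends s a y' y * g y' y : Config E → Config E → R) =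
      - pairCount F z (fun y y' => odd ends s u y y' * kCore ends s a y y' * g y y') := by
    rw [← pairCount_neg']
    congr 1
    funext y y'
    unfold odd kCore
    rw [hg y y']
    ring
  rw [hneg] at hsw
  linarith

omit [LinearOrder R] [IsStrictOrderedRing R] [DecidablePred (· ∈ EA)] [DecidablePred (· ∈ EB)] in
/-- The odd statistic is antisymmetric, `kRed` and `kBlue` are exchanged by the copy swap: the two
counts `f_u · kRed(s, x) · g` and `f_u · kBlue(s, x) · g'` with `g' y y' = g y' y` are opposite. -/
lemma pairCount_odd_kBlue (F : Finset E) (z : Config E) (s u a : V)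
    (g : Config E → Config E → R) :
    pairCount F z (fun y y' => odd ends s u y y' * kBlue ends s a y y' * g y' y) =
      - pairCount F z (fun y y' => odd ends s u y y' * kRed ends s a y y' * g y y') := by
  rw [pairCount_swap, ← pairCount_neg']
  congr 1
  funext y y'
  unfold odd kRed kBlue
  ring

/-- **The split placement, class «outside»**: for `s, u` on the `A`-side and `v, w` on the
`B`-side, `out_s(u, v, w) = 2 · N_A(f_u · kRed(s, x)) · N_B(r_v (1 − r_w))`. -/
theorem stat_split_out (h : IsCut ends x VA VB EA EB) (F : Finset E) (z : Config E)
    {s u v w : V} (hs : s ∈ VA ∪ {x}) (hu : u ∈ VA ∪ {x}) (hv : v ∈ VB) (hw : w ∈ VB) :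
    (stat F z ends s u v (kOut ends s w) : R) =
      2 * pairCount (sideFree EA F) (restrict EA z)
          (fun y y' => odd ends s u y y' * kRed ends s x y y') *
        pairCount (sideFree EB F) (restrict EB z)
          (fun y _ => iL ends x v y * (1 - iL ends x w y)) := by
  have hA := iL_sx_restrictA (R := R) h hs
  have hBv : ∀ y : Config E, (iL ends x v y : R) = iL ends x v (restrict EB y) :=
    fun y => iL_restrictB h (Or.inr rfl) (Or.inl hv) y
  have hBw : ∀ y : Config E, (iL ends x w y : R) = iL ends x w (restrict EB y) :=
    fun y => iL_restrictB h (Or.inr rfl) (Or.inl hw) y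
  have e1 := pairCount_mul_of_cut (R := R) h F z
    (fun y y' => odd ends s u y y' * kRed ends s x y y')
    (fun y _ => iL ends x v y * (1 - iL ends x w y))
    (by intro y y'; rw [odd_restrictA h hs hu y y', kRed_restrict hA y y'])
    (by intro y y'; rw [hBv y, hBw y])
  have e2 := pairCount_mul_of_cut (R := R) h F z
    (fun y y' => odd ends s u y y' * kBlue ends s x y y')
    (fun _ y' => iL ends x v y' * (1 - iL ends x w y'))
    (by intro y y'; rw [odd_restrictA h hs hu y y', kBlue_restrict hA y y'])
    (by intro y y'; rw [hBv y', hBw y'])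
  have e3 := pairCount_mul_of_cut (R := R) h F z
    (fun y y' => odd ends s u y y' * kCore ends s x y y')
    (fun y y' => odd ends x v y y' * kOut ends x w y y')
    (by intro y y'; rw [odd_restrictA h hs hu y y', kCore_restrict hA y y'])
    (by intro y y'
        rw [odd_restrictB h hv y y', kOut_restrict hBw y y'])
  have hsum : (stat F z ends s u v (kOut ends s w) : R) =
      pairCount F z (fun y y' => odd ends s u y y' * kRed ends s x y y' *
        (iL ends x v y * (1 - iL ends x w y))) -
      pairCount F z (fun y y' => odd ends s u y y' * kBlue ends s x y y' *
        (iL ends x v y' * (1 - iL ends x w y'))) +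
      pairCount F z (fun y y' => odd ends s u y y' * kCore ends s x y y' *
        (odd ends x v y y' * kOut ends x w y y')) := by
    rw [← pairCount_sub, ← pairCount_add]
    unfold stat pairCount
    refine Finset.sum_congr rfl fun y _ => ?_
    split_ifs
    · simp only [odd_mul_kOut_split h hs hv hw]
    · rfl
  -- the blue term is the opposite of the red term (A-side swap), the core term vanishes
  have hblue : pairCount (sideFree EA F) (restrict EA z)
      (fun y y' => odd ends s u y y' * kBlue ends s x y y' : Config E → Config E → R) =
      - pairCount (sideFree EA F) (restrict EA z)
        (fun y y' => odd ends s u y y' * kRed ends s x y y') := by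
    have := pairCount_odd_kBlue (R := R) (ends := ends) (sideFree EA F) (restrict EA z) s u x
      (fun _ _ => 1)
    simpa using this
  have hcore : pairCount (sideFree EA F) (restrict EA z)
      (fun y y' => odd ends s u y y' * kCore ends s x y y' : Config E → Config E → R) = 0 := by
    have := pairCount_odd_kCore (R := R) (ends := ends) (sideFree EA F) (restrict EA z) s u x
      (fun _ _ => 1) (fun _ _ => rfl)
    simpa using this
  have hBsw : pairCount (sideFree EB F) (restrict EB z)
      (fun _ y' => iL ends x v y' * (1 - iL ends x w y') : Config E → Config E → R) =
      pairCount (sideFree EB F) (restrict EB z) (fun y _ => iL ends x v y * (1 - iL ends x w y)) := by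
    rw [pairCount_swap]
  rw [hsum, e1, e2, e3, hblue, hcore, hBsw]
  ring

/-- **The split placement, class «red-only»**: `red_s(u, v, w) = N_A(f_u · kRed(s, x)) · N_B(r_v r_w)`. -/
theorem stat_split_red (h : IsCut ends x VA VB EA EB) (F : Finset E) (z : Config E)
    {s u v w : V} (hs : s ∈ VA ∪ {x}) (hu : u ∈ VA ∪ {x}) (hv : v ∈ VB) (hw : w ∈ VB) :
    (stat F z ends s u v (kRed ends s w) : R) =
      pairCount (sideFree EA F) (restrict EA z)
          (fun y y' => odd ends s u y y' * kRed ends s x y y') *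
        pairCount (sideFree EB F) (restrict EB z) (fun y _ => iL ends x v y * iL ends x w y) := by
  have hA := iL_sx_restrictA (R := R) h hs
  have hBv : ∀ y : Config E, (iL ends x v y : R) = iL ends x v (restrict EB y) :=
    fun y => iL_restrictB h (Or.inr rfl) (Or.inl hv) y
  have hBw : ∀ y : Config E, (iL ends x w y : R) = iL ends x w (restrict EB y) :=
    fun y => iL_restrictB h (Or.inr rfl) (Or.inl hw) y
  have e1 := pairCount_mul_of_cut (R := R) h F z
    (fun y y' => odd ends s u y y' * kRed ends s x y y')
    (fun y _ => iL ends x v y * iL ends x w y)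
    (by intro y y'; rw [odd_restrictA h hs hu y y', kRed_restrict hA y y'])
    (by intro y y'; rw [hBv y, hBw y])
  have e3 := pairCount_mul_of_cut (R := R) h F z
    (fun y y' => odd ends s u y y' * kCore ends s x y y')
    (fun y y' => odd ends x v y y' * kRed ends x w y y')
    (by intro y y'; rw [odd_restrictA h hs hu y y', kCore_restrict hA y y'])
    (by intro y y'
        rw [odd_restrictB h hv y y', kRed_restrict hBw y y'])
  have hsum : (stat F z ends s u v (kRed ends s w) : R) =
      pairCount F z (fun y y' => odd ends s u y y' * kRed ends s x y y' *
        (iL ends x v y * iL ends x w y)) +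
      pairCount F z (fun y y' => odd ends s u y y' * kCore ends s x y y' *
        (odd ends x v y y' * kRed ends x w y y')) := by
    rw [← pairCount_add]
    unfold stat pairCount
    refine Finset.sum_congr rfl fun y _ => ?_
    split_ifs
    · simp only [odd_mul_kRed_split h hs hv hw]
    · rfl
  have hcore : pairCount (sideFree EA F) (restrict EA z)
      (fun y y' => odd ends s u y y' * kCore ends s x y y' : Config E → Config E → R) = 0 := by
    have := pairCount_odd_kCore (R := R) (ends := ends) (sideFree EA F) (restrict EA z) s u x
      (fun _ _ => 1) (fun _ _ => rfl)
    simpa using this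
  rw [hsum, e1, e3, hcore]
  ring

omit [DecidablePred (· ∈ EA)] [DecidablePred (· ∈ EB)] in
/-- The `A`-side factor `N_A(f_u · kRed(s, x))` is half of typed Harris for the pair `(u, x)`: it is
nonnegative. -/
lemma pairCount_odd_kRed_nonneg (F : Finset E) (z : Config E) (s u a : V) :
    0 ≤ pairCount F z (fun y y' => odd ends s u y y' * kRed ends s a y y' : Config E → Config E → R) := by
  have hH := stat_one_nonneg (R := R) F z ends s u a
  have hsplit : pairCount F z (fun y y' => odd ends s u y y' * odd ends s a y y' :
      Config E → Config E → R) =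
      pairCount F z (fun y y' => odd ends s u y y' * kRed ends s a y y') -
      pairCount F z (fun y y' => odd ends s u y y' * kBlue ends s a y y') := by
    rw [← pairCount_sub]
    congr 1
    funext y y'
    unfold odd kRed kBlue
    ring
  have hblue : pairCount F z (fun y y' => odd ends s u y y' * kBlue ends s a y y' :
      Config E → Config E → R) =
      - pairCount F z (fun y y' => odd ends s u y y' * kRed ends s a y y') := by
    have := pairCount_odd_kBlue (R := R) (ends := ends) F z s u a (fun _ _ => 1)
    simpa using this
  rw [hsplit, hblue] at hH
  linarith

/-- **(TB13) holds outright on every split placement** (`s, u` on one side, `v, w` on the other). -/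
theorem tb13_split (h : IsCut ends x VA VB EA EB) (F : Finset E) (z : Config E)
    {s u v w : V} (hs : s ∈ VA ∪ {x}) (hu : u ∈ VA ∪ {x}) (hv : v ∈ VB) (hw : w ∈ VB) :
    0 ≤ (stat F z ends s u v (kOut ends s w) : R) := by
  rw [stat_split_out h F z hs hu hv hw]
  have c := pairCount_nonneg' (R := R) (sideFree EB F) (restrict EB z)
    (fun y _ => iL ends x v y * (1 - iL ends x w y))
    (fun y _ => mul_nonneg (iL_nonneg ends x v y) (sub_nonneg.2 (iL_le_one ends x w y)))
  exact mul_nonneg (mul_nonneg (by norm_num) (pairCount_odd_kRed_nonneg _ _ s u x)) c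

/-- **(OS) holds outright on every split placement.** -/
theorem os_split (h : IsCut ends x VA VB EA EB) (F : Finset E) (z : Config E)
    {s u v w : V} (hs : s ∈ VA ∪ {x}) (hu : u ∈ VA ∪ {x}) (hv : v ∈ VB) (hw : w ∈ VB) :
    0 ≤ (stat F z ends s u v (kOut ends s w) : R) + stat F z ends s u v (kRed ends s w) := by
  rw [stat_split_out h F z hs hu hv hw, stat_split_red h F z hs hu hv hw]
  have c := pairCount_nonneg' (R := R) (sideFree EB F) (restrict EB z)
    (fun y _ => iL ends x v y * (1 - iL ends x w y))
    (fun y _ => mul_nonneg (iL_nonneg ends x v y) (sub_nonneg.2 (iL_le_one ends x w y)))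
  have c' := pairCount_nonneg' (R := R) (sideFree EB F) (restrict EB z)
    (fun y _ => iL ends x v y * iL ends x w y)
    (fun y _ => mul_nonneg (iL_nonneg ends x v y) (iL_nonneg ends x w y))
  have a := pairCount_odd_kRed_nonneg (R := R) (ends := ends) (sideFree EA F) (restrict EA z) s u x
  have := mul_nonneg (mul_nonneg (by norm_num : (0 : R) ≤ 2) a) c
  have := mul_nonneg a c'
  linarith

end Split

end PosClass

end Summit.Ventures.PercRepro2
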